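import Mathlib
import HarnessLib
import Summits.Ventures.LatticeQCDFlow.Exactness.SphereGeodesicExponential

/-!
# The geodesic rotation `e^{τA(x,p)}` is a linear isometry: frames stay orthonormal along the sphere leapfrog

HONEST FRAMING: exact (Metropolis-corrected) sampling algorithms for lattice gauge theory;
figures of merit are autocorrelation/cost numbers at stated couplings and volumes; no
continuum-physics claim.

Venture `LatticeQCDFlow` (cell pub-lqcd), topic `Exactness`, FANOUT row 9 (eng-latcore, the
engine `latflow.core.cpn_2d.HMCCPN`, exact geodesic site update).  NEW WORK of the cell over the tree
(`SphereGeodesicExponential.lean`: the skew-adjoint generator `geodGen x p`, `geodesicDrift_eq_exp`) and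
Mathlib (`HasDerivAt.norm_sq`, `hasDerivAt_exp_smul_const'`, `is_const_of_deriv_eq_zero`); nothing is
cited as a fact; no number.

THE POINT (third brick of the body-frame reduction; design in HOME/eng-latcore/HANDOFF.md GEN-19): in
the body frame the drift multiplies the frame by `e^{τA(e,q)}`; for the frame to remain an isometry
(so that the conjugation rule `e^{τA(Wx,Wp)}W = W e^{τA(x,p)}` of `SphereAmbientDriftExponential.lean`
applies at the next step) one needs `‖e^{τA} y‖ = ‖y‖` for ALL `y` — not only for the generating pair
`(x, p)`.  Proof: `s ↦ ‖e^{sA}y‖²` has derivative `2⟪e^{sA}y, A e^{sA}y⟫ = 0` because `A` is skew-adjoint.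

* `inner_geodGen_self` (`⟪A z, z⟫ = 0`), **`norm_exp_geodGen`** (`‖e^{τA(x,p)} y‖ = ‖y‖` for all
  `x, p, y, τ`), `inner_exp_geodGen` (`⟪e^{τA}y, e^{τA}y'⟫ = ⟪y, y'⟫`, polarization),
  **`geodRot x p τ`** — `e^{τA(x,p)}` as a linear isometry `V →ₗᵢ[ℝ] V` (`geodRot_apply`), and
  `geodesicDrift_eq_geodRot` (row 7's drift = `(geodRot x π τ x, geodRot x π τ π)`).

NOT CLAIMED: surjectivity / the inverse `e^{−τA}` packaged as an equivalence (true; not needed for the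
norm bookkeeping), the group law in `τ`, matrices, anything quantitative.
-/

noncomputable section

namespace Summit.Ventures.LatticeQCDFlow.Exactness

open Real NormedSpace
open scoped InnerProductSpace

variable {V : Type*} [NormedAddCommGroup V] [InnerProductSpace ℝ V]

/-- `⟪A z, z⟫ = 0`: the generator is skew-adjoint. -/
theorem inner_geodGen_self (x p z : V) : ⟪geodGen x p z, z⟫_ℝ = 0 := by
  have h := inner_geodGen_symm x p z z
  rw [real_inner_comm (geodGen x p z) z] at h
  linarith

variable [CompleteSpace V]

/-- **`‖e^{τA(x,p)} y‖ = ‖y‖`** for all `x, p, y, τ`: the geodesic rotation is norm-preserving. -/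
theorem norm_exp_geodGen (x p y : V) (t : ℝ) : ‖exp (t • geodGen x p) y‖ = ‖y‖ := by
  set A := geodGen x p with hA
  have hd : ∀ s, HasDerivAt (fun r : ℝ => ‖exp (r • A) y‖ ^ 2) 0 s := by
    intro s
    have h1 : HasDerivAt (fun r : ℝ => exp (r • A) y) ((A * exp (s • A)) y) s :=
      ((hasDerivAt_exp_smul_const' (𝕂 := ℝ) A s).clm_apply (hasDerivAt_const s y)).congr_deriv (by simp)
    refine h1.norm_sq.congr_deriv ?_
    have h0 : ⟪exp (s • A) y, (A * exp (s • A)) y⟫_ℝ = 0 := by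
      show ⟪exp (s • A) y, A (exp (s • A) y)⟫_ℝ = 0
      rw [real_inner_comm, hA, inner_geodGen_self]
    rw [h0, mul_zero]
  have hconst := is_const_of_deriv_eq_zero (f := fun r : ℝ => ‖exp (r • A) y‖ ^ 2)
    (fun s => (hd s).differentiableAt) (fun s => (hd s).deriv) t 0
  simp only [zero_smul, NormedSpace.exp_zero, one_apply_eq_self] at hconst
  have h := congrArg Real.sqrt hconst
  rwa [Real.sqrt_sq (norm_nonneg _), Real.sqrt_sq (norm_nonneg _)] at h

/-- Inner products are preserved: `⟪e^{τA}y, e^{τA}y'⟫ = ⟪y, y'⟫` (polarization). -/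
theorem inner_exp_geodGen (x p y y' : V) (t : ℝ) :
    ⟪exp (t • geodGen x p) y, exp (t • geodGen x p) y'⟫_ℝ = ⟪y, y'⟫_ℝ := by
  rw [real_inner_eq_norm_add_mul_self_sub_norm_mul_self_sub_norm_mul_self_div_two, ← map_add,
    norm_exp_geodGen, norm_exp_geodGen, norm_exp_geodGen,
    ← real_inner_eq_norm_add_mul_self_sub_norm_mul_self_sub_norm_mul_self_div_two]

/-- **The geodesic rotation as a linear isometry** `geodRot x p τ = e^{τA(x,p)} : V →ₗᵢ[ℝ] V`. -/
def geodRot (x p : V) (t : ℝ) : V →ₗᵢ[ℝ] V where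
  toLinearMap := (exp (t • geodGen x p) : V →L[ℝ] V).toLinearMap
  norm_map' := fun y => norm_exp_geodGen x p y t

/-- Pointwise: `geodRot x p τ y = e^{τA(x,p)} y`. -/
@[simp] theorem geodRot_apply (x p y : V) (t : ℝ) : geodRot x p t y = exp (t • geodGen x p) y := rfl

/-- Row 7's exact geodesic drift in terms of the isometry: `geodesicDrift τ (x, π) = (R x, R π)`,
`R = geodRot x π τ` (`‖x‖ = 1`, `π ⊥ x`). -/
theorem geodesicDrift_eq_geodRot {x p : V} (hx : ‖x‖ = 1) (hxp : ⟪x, p⟫_ℝ = 0) (t : ℝ) :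
    geodesicDrift t (x, p) = (geodRot x p t x, geodRot x p t p) :=
  geodesicDrift_eq_exp hx hxp t

end Summit.Ventures.LatticeQCDFlow.Exactness
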